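import Literature.NumberTheory.GaloisRepresentations.TateDualityDevissage
import HarnessLib

/-!
# Local Tate duality: double dual and the counting step "met en dualité les groupes finis"

Serre, *Cohomologie galoisienne*, II §5.2 Thm. 2, concludes that the cup product
`H¹(k, A) × H¹(k, A') → ℤ/n` "met en dualité les groupes finis `H¹(k, A)` et `H¹(k, A')`".  Once the
left adjoint `H¹(G, M) → Hom(H¹(G, M^D), ℤ/n)` is known to be injective **for all** finite `M`
(the dévissage, `TateDualityDevissage.lean`, and its transfer), perfectness is pure counting, using
`M ≅ M^DD`: `|H¹(M)| ≤ |H¹(M^D)| ≤ |H¹(M^DD)| = |H¹(M)|`.  This file provides: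

* `nsmul_continuousCohomology_one_eq_zero` — `n · H¹(G, X) = 0` if `n X = 0`;
* `continuousCohomologyEquivOfIso` — `Hⁿ(G, X) ≃ Hⁿ(G, Y)` for `X ≅ Y` (functoriality), hence
  equality of cardinalities;
* `ContinuousRep.biDualIso` — the isomorphism `M ≅ M^DD`, `m ↦ (f ↦ f m)` for a finite `M` killed
  by `n` and `Ω ≃ ℤ/n` (injective because maps to `ℤ/n` separate points,
  `exists_addMonoidHom_zmod_apply_ne_zero`; bijective by counting `|M^DD| = |M^D| = |M|`);
* `ContinuousRep.dualityPairing_bijective_of_injective` — if `H¹(G, M)` and `H¹(G, M^D)` are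
  finite and the left adjoints for `M` **and** for `M^D` are injective, then both adjoints of the
  duality pairing of `M` are bijective.

## References

* J.-P. Serre, *Cohomologie galoisienne* (1994/1997), II §5.2 Thm. 2. [SerreGaloisCohomology1997]
* J. S. Milne, *Arithmetic Duality Theorems* (2006), I §0 (`M^DD = M` for finite `M`), I Cor. 2.3.
  [MilneADT2006]
-/

noncomputable section

open CategoryTheory Limits Function

universe u w

namespace Literature.NumberTheory.GaloisRepresentations

open _root_.TopRep _root_.ContRepresentation _root_.ContinuousCohomology

/-! ### Torsion of `H¹` and invariance of `Hⁿ` under isomorphism -/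

section Generic

variable {R : Type w} [CommRing R] [TopologicalSpace R]
variable {G : Type u} [Group G] [TopologicalSpace G] [IsTopologicalGroup G]

/-- **`H¹(G, X)` is killed by `n` if `X` is.** [folklore] -/
theorem nsmul_continuousCohomology_one_eq_zero (X : TopRep.{u} R G) (n : ℕ)
    (hX : ∀ x : X, n • x = 0) (z : continuousCohomology 1 X) : n • z = 0 := by
  obtain ⟨f, rfl⟩ := oneCocycleClass_surjective X z
  have hf : (n : R) • f = 0 := Subtype.ext (ContinuousMap.ext fun q => by
    change (n : R) • f.1 q = 0
    rw [Nat.cast_smul_eq_nsmul, hX])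
  rw [← Nat.cast_smul_eq_nsmul R, ← oneCocycleClass_smul, hf, oneCocycleClass_zero]

/-- `Hⁿ(e.inv) ∘ Hⁿ(e.hom) = id` on elements, for an isomorphism `e : X ≅ Y`
(`ContinuousCohomology.map_comp`, `map_id`). [folklore] -/
theorem cohomologyMap_inv_hom_apply {X Y : TopRep.{u} R G} (e : X ≅ Y) (q : ℕ)
    (x : continuousCohomology q X) :
    (cohomologyMap e.inv q).hom ((cohomologyMap e.hom q).hom x) = x := by
  have hcomp : cohomologyMap e.hom q ≫ cohomologyMap e.inv q = 𝟙 _ := by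
    rw [cohomologyMap, cohomologyMap, ← ContinuousCohomology.map_comp]
    refine map_id_eq_id _ (fun y => ?_) q
    change e.inv.hom (e.hom.hom y) = y
    rw [← TopRep.comp_apply, e.hom_inv_id, TopRep.id_apply]
  have hx := congr_arg (fun φ => φ.hom x) hcomp
  simpa using hx

/-- **`Hⁿ(G, X) ≃ Hⁿ(G, Y)` for isomorphic topological representations** (the maps induced by
`e.hom`, `e.inv`, inverse to each other by `ContinuousCohomology.map_comp`, `map_id`). [folklore] -/
def continuousCohomologyEquivOfIso {X Y : TopRep.{u} R G} (e : X ≅ Y) (q : ℕ) :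
    continuousCohomology q X ≃ continuousCohomology q Y where
  toFun := (cohomologyMap e.hom q).hom
  invFun := (cohomologyMap e.inv q).hom
  left_inv x := cohomologyMap_inv_hom_apply e q x
  right_inv y := cohomologyMap_inv_hom_apply e.symm q y

/-- Isomorphic topological representations have cohomology groups of the same cardinality.
[folklore] -/
theorem natCard_continuousCohomology_eq_of_iso {X Y : TopRep.{u} R G} (e : X ≅ Y) (q : ℕ) :
    Nat.card (continuousCohomology q X) = Nat.card (continuousCohomology q Y) :=
  Nat.card_congr (continuousCohomologyEquivOfIso e q)

end Generic

/-! ### The double dual `M ≅ M^DD` -/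

namespace ContinuousRep

section BiDual

variable {G : Type u} [Group G] [TopologicalSpace G] [IsTopologicalGroup G]
variable {M : Type u} [AddCommGroup M] [TopologicalSpace M] [DiscreteTopology M] [Finite M]
variable {Ω : Type u} [AddCommGroup Ω] [TopologicalSpace Ω] [DiscreteTopology Ω] [Finite Ω]
variable (ρ : ContinuousRep G ℤ M) (ω : ContinuousRep G ℤ Ω)

/-- **The bidual map `M → M^DD`, `m ↦ (f ↦ f m)`**, a morphism of discrete `G`-modules
(`(σ ev_m)(f) = σ ((σ⁻¹ f)(m)) = σ σ⁻¹ f(σ m) = ev_{σ m}(f)`). [cite: MilneADT2006, I §0] -/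
def biDualHom : ρ.toTopRep ⟶ ((ρ.homRep ω).homRep ω).toTopRep :=
  TopRep.ofHom
    { toFun := fun m => HomCarrier.ofAddMonoidHom
        { toFun := fun f : HomCarrier M Ω => f m
          map_zero' := rfl
          map_add' := fun _ _ => rfl }
      map_add' := fun m m' => HomCarrier.ext fun f => map_add f m m'
      map_smul' := fun c m => HomCarrier.ext fun f => by
        change f (c • m) = c • f m
        rw [map_zsmul]
      cont := continuous_of_discreteTopology
      isIntertwining' := fun σ => ContinuousLinearMap.ext fun m => HomCarrier.ext fun f => by
        change f (ρ σ m) = ω σ ((ρ.homRep ω) σ⁻¹ f m)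
        rw [homRep_apply_apply_apply, inv_inv, ← Module.End.mul_apply, ← map_mul, mul_inv_cancel,
          map_one, Module.End.one_apply] }

/-- Unfolding `biDualHom`. [folklore] -/
@[simp] theorem biDualHom_hom_apply_apply (m : M) (f : HomCarrier M Ω) :
    (ρ.biDualHom ω).hom m f = f m := rfl

/-- **`M → M^DD` is bijective** for a finite `M` killed by `n` and `Ω ≃ ℤ/n`: injective because
additive maps `M → ℤ/n` separate points (`exists_addMonoidHom_zmod_apply_ne_zero`), then bijective
by `|M^DD| = |M^D| = |M|`. [cite: MilneADT2006, I §0] -/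
theorem biDualHom_bijective {n : ℕ} [NeZero n] (eΩ : Ω ≃+ ZMod n) (hM : ∀ m : M, n • m = 0) :
    Bijective (ρ.biDualHom ω).hom := by
  have hinj : Injective (ρ.biDualHom ω).hom := by
    refine (injective_iff_map_eq_zero _).2 fun m hm => by_contra fun hm0 => ?_
    obtain ⟨φ, hφ⟩ := exists_addMonoidHom_zmod_apply_ne_zero hM hm0
    refine hφ ?_
    have := congrArg (fun F : HomCarrier (HomCarrier M Ω) Ω =>
      F (HomCarrier.ofAddMonoidHom (eΩ.symm.toAddMonoidHom.comp φ))) hm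
    change eΩ.symm (φ m) = (0 : HomCarrier (HomCarrier M Ω) Ω) _ at this
    rw [HomCarrier.zero_apply] at this
    simpa using congrArg eΩ this
  refine (Nat.bijective_iff_injective_and_card _).2 ⟨hinj, ?_⟩
  have hD : ∀ f : HomCarrier M Ω, n • f = 0 := fun f => HomCarrier.nsmul_eq_zero_of_left hM f
  rw [HomCarrier.natCard_eq eΩ hD, HomCarrier.natCard_eq eΩ hM]

/-- **The isomorphism `M ≅ M^DD`** of topological representations. [cite: MilneADT2006, I §0] -/
def biDualIso {n : ℕ} [NeZero n] (eΩ : Ω ≃+ ZMod n) (hM : ∀ m : M, n • m = 0) :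
    ρ.toTopRep ≅ ((ρ.homRep ω).homRep ω).toTopRep :=
  topRepIsoOfEquiv
    ({ (Equiv.ofBijective _ (ρ.biDualHom_bijective ω eΩ hM)) with
        map_add' := fun m m' => map_add (ρ.biDualHom ω).hom m m'
        map_smul' := fun c m => (ρ.biDualHom ω).hom.toContinuousLinearMap.map_smul c m
        continuous_toFun := continuous_of_discreteTopology
        continuous_invFun := continuous_of_discreteTopology } : M ≃L[ℤ] HomCarrier (HomCarrier M Ω) Ω)
    fun g m => TopRep.hom_comm_apply (ρ.biDualHom ω) g m

/-- `|H¹(G, M^DD)| = |H¹(G, M)|`. [folklore] -/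
theorem natCard_continuousCohomology_biDual {n : ℕ} [NeZero n] (eΩ : Ω ≃+ ZMod n)
    (hM : ∀ m : M, n • m = 0) (q : ℕ) :
    Nat.card (continuousCohomology q ((ρ.homRep ω).homRep ω).toTopRep) =
      Nat.card (continuousCohomology q ρ.toTopRep) :=
  (natCard_continuousCohomology_eq_of_iso (ρ.biDualIso ω eΩ hM) q).symm

end BiDual

/-! ### Perfectness by counting -/

section Counting

variable {G : Type u} [Group G] [TopologicalSpace G] [IsTopologicalGroup G] [LocallyCompactSpace G]
variable {M : Type u} [AddCommGroup M] [TopologicalSpace M] [DiscreteTopology M] [Finite M]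
variable {Ω : Type u} [AddCommGroup Ω] [TopologicalSpace Ω] [DiscreteTopology Ω] [Finite Ω]

/-- **Perfectness of the duality pairing from injectivity for `M` and `M^D`** ("met en dualité
les groupes finis", Serre II §5.2 Thm. 2): if `H¹(G, M)` and `H¹(G, M^D)` are finite, `n M = 0`,
`Ω ≃ ℤ/n`, and the left adjoints `a ↦ ι(a ∪ ·)` are injective for `M` and for `M^D`, then both
adjoints of `H¹(G, M) × H¹(G, M^D) → ℤ/n` are bijective.  Counting:
`|H¹(M)| ≤ |H¹(M^D)| ≤ |H¹(M^DD)| = |H¹(M)|`. [cite: SerreGaloisCohomology1997, II §5.2 Thm. 2] -/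
theorem dualityPairing_bijective_of_injective (ρ : ContinuousRep G ℤ M) (ω : ContinuousRep G ℤ Ω)
    {n : ℕ} [NeZero n] (eΩ : Ω ≃+ ZMod n) (ι : continuousCohomology 2 ω.toTopRep →+ ZMod n)
    (hM : ∀ m : M, n • m = 0)
    [Finite (continuousCohomology 1 ρ.toTopRep)] [Finite (continuousCohomology 1 (ρ.homRep ω).toTopRep)]
    (h₁ : Injective (ρ.dualityPairing ω ι)) (h₂ : Injective ((ρ.homRep ω).dualityPairing ω ι)) :
    Bijective (ρ.dualityPairing ω ι) ∧ Bijective (ρ.dualityPairing ω ι).flip := by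
  have hD : ∀ f : HomCarrier M Ω, n • f = 0 := fun f => HomCarrier.nsmul_eq_zero_of_left hM f
  have hDD : ∀ f : HomCarrier (HomCarrier M Ω) Ω, n • f = 0 := fun f =>
    HomCarrier.nsmul_eq_zero_of_left hD f
  have hA : ∀ a : continuousCohomology 1 ρ.toTopRep, n • a = 0 :=
    nsmul_continuousCohomology_one_eq_zero _ n hM
  have hB : ∀ b : continuousCohomology 1 (ρ.homRep ω).toTopRep, n • b = 0 :=
    nsmul_continuousCohomology_one_eq_zero _ n hD
  have hC : ∀ c : continuousCohomology 1 ((ρ.homRep ω).homRep ω).toTopRep, n • c = 0 :=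
    nsmul_continuousCohomology_one_eq_zero _ n hDD
  haveI : Finite (continuousCohomology 1 ((ρ.homRep ω).homRep ω).toTopRep) :=
    Finite.of_equiv _ (continuousCohomologyEquivOfIso (ρ.biDualIso ω eΩ hM) 1)
  haveI := finite_addMonoidHom_zmod (continuousCohomology 1 (ρ.homRep ω).toTopRep) n
  haveI := finite_addMonoidHom_zmod (continuousCohomology 1 ((ρ.homRep ω).homRep ω).toTopRep) n
  -- `|H¹(M)| ≤ |H¹(M^D)| ≤ |H¹(M^DD)| = |H¹(M)|`
  have c₁ : Nat.card (continuousCohomology 1 ρ.toTopRep) ≤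
      Nat.card (continuousCohomology 1 (ρ.homRep ω).toTopRep) :=
    (Nat.card_le_card_of_injective _ h₁).trans_eq (Nat.card_addMonoidHom_zmod hB)
  have c₂ : Nat.card (continuousCohomology 1 (ρ.homRep ω).toTopRep) ≤
      Nat.card (continuousCohomology 1 ρ.toTopRep) :=
    ((Nat.card_le_card_of_injective _ h₂).trans_eq (Nat.card_addMonoidHom_zmod hC)).trans_eq
      (ρ.natCard_continuousCohomology_biDual ω eΩ hM 1)
  have hbij : Bijective (ρ.dualityPairing ω ι) :=
    (Nat.bijective_iff_injective_and_card _).2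
      ⟨h₁, by rw [Nat.card_addMonoidHom_zmod hB]; exact le_antisymm c₁ c₂⟩
  have := AddMonoidHom.bijective_of_bijective_flip hB hA (ρ.dualityPairing ω ι).flip hbij
  exact ⟨hbij, this.1⟩

end Counting

end ContinuousRep

end Literature.NumberTheory.GaloisRepresentations

end
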